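import Mathlib.Analysis.Calculus.ContDiff.Basic
import Mathlib.Analysis.Calculus.ContDiff.Bounds
import Mathlib.Analysis.Calculus.FDeriv.Symmetric
import Mathlib.Analysis.Calculus.Deriv.Comp
import Mathlib.Analysis.Calculus.Deriv.Mul
import Mathlib.Analysis.Calculus.Deriv.Pi
import Mathlib.Analysis.Calculus.IteratedDeriv.Defs
import HarnessLib

/-!
# Iterated partial derivatives along words of coordinate directions (bookkeeping for Bhardwaj–van den Dries 2022, §6)

Topic `Literature/ModelTheory/ExponentialFields`; pure-analysis infrastructure in the cone of
the named fact `PilaWilkie2006_thm_1_8`.  Bhardwaj–van den Dries 2022, §6 (Lemma 6.2, Cor.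
6.3, Cor. 6.4 — the analytic heart of the o-minimal Yomdin–Gromov theorem) is phrased in terms
of the partial derivatives `f^{(α)}` of functions on open subsets of `ℝ^{m+1}`, distinguishing
the last variable (*"`f_φ^{(α)}` is strongly bounded on `V_l` for all `α ∈ ℕ^{m+1}` with
`|α| ≤ k`, `α_{m+1} ≤ l`"*), while the parametrization statements of the tree are phrased with
Mathlib's Fréchet `iteratedFDeriv`.  This file provides the dictionary:

* `pderiv i H x = DH(x) e_i` and iterated partials `pderivWord w H` along a word `w` of
  coordinate directions (definitions);
* regularity (`ContDiffOn.pderiv`, `ContDiffOn.pderivWord`), the identities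
  `D^q(∂_i G)(x)(u) = D^{q+1}G(x)(u, e_i)` (`iteratedFDeriv_pderiv_apply`) and
  `D^q H(x)(e_r) = ∂^{r} H(x)` (`iteratedFDeriv_apply_single`), and the two norm comparisons
  `|∂^w H| ≤ ‖D^{|w|} H‖` (`abs_pderivWord_le`) and `‖D^q H‖ ≤ N^q · max_w |∂^w H|`
  (`norm_iteratedFDeriv_le_of_pderivWord`);
* partials as one-variable derivatives of sections (`hasDerivAt_section_of_differentiableAt`,
  `pderivWord_replicate_last`), congruence, the product rule, functions of one coordinate,
  and the chain rule through the change of the last variable `I_ψ(x) = (x', ψ(x_{m+1}))` of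
  BvdD §6 (`pderiv_comp_changeLast_of_ne`, `pderiv_comp_changeLast_last`);
* Schwarz symmetry: iterated partials of a `C^{|w|}` function are invariant under permutations
  of the word (`pderiv_comm`, `pderivWord_perm`).

No named facts; the only definitions are `pderiv` and `pderivWord`.

## References

* N. Bhardwaj, L. van den Dries, *On the Pila–Wilkie theorem*, Expo. Math. 40 (2022), §4
  (notations), §6. [BhardwajVanDenDries2022]
-/

noncomputable section

open Set Filter Topology

namespace Literature.ModelTheory.ExponentialFields

/-! ### Partial derivatives along coordinate directions, via the Fréchet derivative -/

section PDeriv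

variable {N : ℕ}

/-- The partial derivative of `H : ℝ^N → ℝ` in the coordinate direction `i`, read off from the
Fréchet derivative: `∂_i H (x) = DH(x) e_i` (junk where `H` is not differentiable).
[folklore] -/
def pderiv (i : Fin N) (H : (Fin N → ℝ) → ℝ) : (Fin N → ℝ) → ℝ :=
  fun x => fderiv ℝ H x (Pi.single i 1)

/-- Iterated partial derivatives along a word of coordinate directions (the head of the list is
applied last): `∂^{i :: w} H = ∂_i (∂^w H)`. [folklore] -/
def pderivWord : List (Fin N) → ((Fin N → ℝ) → ℝ) → (Fin N → ℝ) → ℝ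
  | [], H => H
  | i :: w, H => pderiv i (pderivWord w H)

/-- Unfolding: the empty word. [folklore] -/
@[simp] theorem pderivWord_nil (H : (Fin N → ℝ) → ℝ) : pderivWord [] H = H := rfl

/-- Unfolding: `∂^{i :: w} = ∂_i ∂^w`. [folklore] -/
@[simp] theorem pderivWord_cons (i : Fin N) (w : List (Fin N)) (H : (Fin N → ℝ) → ℝ) :
    pderivWord (i :: w) H = pderiv i (pderivWord w H) := rfl

/-- Concatenated words. [folklore] -/
theorem pderivWord_append (w₁ w₂ : List (Fin N)) (H : (Fin N → ℝ) → ℝ) :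
    pderivWord (w₁ ++ w₂) H = pderivWord w₁ (pderivWord w₂ H) := by
  induction w₁ with
  | nil => rfl
  | cons i w ih => simp [ih]

/-- The basis vectors have norm `≤ 1` (sup norm). [folklore] -/
theorem norm_single_le_one (i : Fin N) : ‖(Pi.single i 1 : Fin N → ℝ)‖ ≤ 1 := by
  rw [pi_norm_le_iff_of_nonneg zero_le_one]
  intro j
  by_cases h : j = i
  · subst h; simp
  · simp [Pi.single_eq_of_ne h]

/-- `∂_i` as a composition with the evaluation at `e_i`. [folklore] -/
theorem pderiv_eq_comp (i : Fin N) (H : (Fin N → ℝ) → ℝ) :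
    pderiv i H = (ContinuousLinearMap.apply ℝ ℝ (Pi.single i 1 : Fin N → ℝ)) ∘ (fderiv ℝ H) := rfl

/-- **Regularity of partial derivatives**: if `H` is `C^{n+1}` on an open `U` then `∂_i H` is
`C^n` on `U`. [folklore] -/
theorem ContDiffOn.pderiv {U : Set (Fin N → ℝ)} (hU : IsOpen U) {H : (Fin N → ℝ) → ℝ} {n : ℕ}
    (hH : ContDiffOn ℝ ((n + 1 : ℕ) : WithTop ℕ∞) H U) (i : Fin N) : ContDiffOn ℝ n (pderiv i H) U := by
  rw [pderiv_eq_comp]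
  exact (ContinuousLinearMap.apply ℝ ℝ (Pi.single i 1 : Fin N → ℝ)).contDiff.comp_contDiffOn
    (hH.fderiv_of_isOpen hU (by exact_mod_cast le_rfl))

/-- Iterated partial derivatives of a `C^n` function along a word of length `≤ n` are
`C^{n - |w|}`. [folklore] -/
theorem ContDiffOn.pderivWord {U : Set (Fin N → ℝ)} (hU : IsOpen U) {H : (Fin N → ℝ) → ℝ} :
    ∀ (w : List (Fin N)) {n : ℕ}, ContDiffOn ℝ ((n + w.length : ℕ) : WithTop ℕ∞) H U → ContDiffOn ℝ n (pderivWord w H) U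
  | [], n, hH => by simpa using hH
  | i :: w, n, hH => by
    rw [pderivWord_cons]
    have h : ContDiffOn ℝ (((n + 1) + w.length : ℕ) : WithTop ℕ∞) H U := by
      rw [List.length_cons] at hH
      rwa [show n + 1 + w.length = n + (w.length + 1) by ring]
    have h' := ContDiffOn.pderivWord hU w h
    exact ContDiffOn.pderiv hU (by exact_mod_cast h') i

/-- **Partial derivatives and the iterated Fréchet derivative**: for `G` of class `C^{q+1}` on an
open `U`, `D^q(∂_i G)(x)(u) = D^{q+1}G(x)(u, e_i)`. [folklore] -/
theorem iteratedFDeriv_pderiv_apply {U : Set (Fin N → ℝ)} (hU : IsOpen U) {G : (Fin N → ℝ) → ℝ}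
    {q : ℕ} (hG : ContDiffOn ℝ ((q + 1 : ℕ) : WithTop ℕ∞) G U) (i : Fin N) {x : Fin N → ℝ} (hx : x ∈ U)
    (u : Fin q → (Fin N → ℝ)) :
    iteratedFDeriv ℝ q (pderiv i G) x u = iteratedFDeriv ℝ (q + 1) G x (Fin.snoc u (Pi.single i 1)) := by
  rw [← iteratedFDerivWithin_of_isOpen _ hU hx, ← iteratedFDerivWithin_of_isOpen _ hU hx,
    iteratedFDerivWithin_succ_apply_right hU.uniqueDiffOn hx, Fin.init_snoc, Fin.snoc_last]
  -- `∂_i G = (apply e_i) ∘ fderivWithin G U` on `U`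
  have heq : EqOn (pderiv i G) ((ContinuousLinearMap.apply ℝ ℝ (Pi.single i 1 : Fin N → ℝ)) ∘
      (fun y => fderivWithin ℝ G U y)) U := by
    intro y hy
    simp only [pderiv, Function.comp_apply, ContinuousLinearMap.apply_apply, fderivWithin_of_isOpen hU hy]
  rw [iteratedFDerivWithin_congr heq hx]
  have hf : ContDiffOn ℝ q (fun y => fderivWithin ℝ G U y) U :=
    ((contDiffOn_succ_iff_fderivWithin hU.uniqueDiffOn).mp (by exact_mod_cast hG)).2.2
  rw [(ContinuousLinearMap.apply ℝ ℝ (Pi.single i 1 : Fin N → ℝ)).iteratedFDerivWithin_comp_left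
    (hf x hx) hU.uniqueDiffOn hx le_rfl]
  rfl

/-- **Norm comparison, one direction**: `‖D^q(∂_i G)(x)‖ ≤ ‖D^{q+1} G(x)‖`. [folklore] -/
theorem norm_iteratedFDeriv_pderiv_le {U : Set (Fin N → ℝ)} (hU : IsOpen U) {G : (Fin N → ℝ) → ℝ}
    {q : ℕ} (hG : ContDiffOn ℝ ((q + 1 : ℕ) : WithTop ℕ∞) G U) (i : Fin N) {x : Fin N → ℝ} (hx : x ∈ U) :
    ‖iteratedFDeriv ℝ q (pderiv i G) x‖ ≤ ‖iteratedFDeriv ℝ (q + 1) G x‖ := by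
  refine ContinuousMultilinearMap.opNorm_le_bound (norm_nonneg _) fun u => ?_
  rw [iteratedFDeriv_pderiv_apply hU hG i hx u]
  refine (ContinuousMultilinearMap.le_opNorm _ _).trans ?_
  rw [Fin.prod_univ_castSucc]
  simp only [Fin.snoc_castSucc, Fin.snoc_last]
  refine mul_le_mul_of_nonneg_left ?_ (norm_nonneg _)
  exact mul_le_of_le_one_right (Finset.prod_nonneg fun _ _ => norm_nonneg _) (norm_single_le_one i)

/-- **Iterated partials are bounded by the Fréchet derivative**: for `H` of class `C^n` on an
open `U` and a word `w` with `q + |w| ≤ n`, `‖D^q(∂^w H)(x)‖ ≤ ‖D^{q+|w|} H(x)‖`; in particular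
`|∂^w H(x)| ≤ ‖D^{|w|} H(x)‖`. [folklore] -/
theorem norm_iteratedFDeriv_pderivWord_le {U : Set (Fin N → ℝ)} (hU : IsOpen U) {H : (Fin N → ℝ) → ℝ} :
    ∀ (w : List (Fin N)) {q : ℕ}, ContDiffOn ℝ ((q + w.length : ℕ) : WithTop ℕ∞) H U → ∀ {x}, x ∈ U →
      ‖iteratedFDeriv ℝ q (pderivWord w H) x‖ ≤ ‖iteratedFDeriv ℝ (q + w.length) H x‖
  | [], q, _, x, _ => by simp
  | i :: w, q, hH, x, hx => by
    rw [pderivWord_cons]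
    have hH' : ContDiffOn ℝ (((q + 1) + w.length : ℕ) : WithTop ℕ∞) H U := by
      rw [List.length_cons] at hH
      rwa [show q + 1 + w.length = q + (w.length + 1) by ring]
    have hG : ContDiffOn ℝ ((q + 1 : ℕ) : WithTop ℕ∞) (pderivWord w H) U := ContDiffOn.pderivWord hU w hH'
    calc ‖iteratedFDeriv ℝ q (pderiv i (pderivWord w H)) x‖
        ≤ ‖iteratedFDeriv ℝ (q + 1) (pderivWord w H) x‖ := norm_iteratedFDeriv_pderiv_le hU hG i hx
      _ ≤ ‖iteratedFDeriv ℝ ((q + 1) + w.length) H x‖ := norm_iteratedFDeriv_pderivWord_le hU w hH' hx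
      _ = ‖iteratedFDeriv ℝ (q + (i :: w).length) H x‖ := by
          rw [List.length_cons, show q + 1 + w.length = q + (w.length + 1) by ring]

/-- `|∂^w H(x)| ≤ ‖D^{|w|} H(x)‖` for `H` of class `C^{|w|}` on an open `U ∋ x`. [folklore] -/
theorem abs_pderivWord_le {U : Set (Fin N → ℝ)} (hU : IsOpen U) {H : (Fin N → ℝ) → ℝ}
    (w : List (Fin N)) (hH : ContDiffOn ℝ (w.length : WithTop ℕ∞) H U) {x : Fin N → ℝ} (hx : x ∈ U) :
    |pderivWord w H x| ≤ ‖iteratedFDeriv ℝ w.length H x‖ := by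
  have h := norm_iteratedFDeriv_pderivWord_le hU w (q := 0) (by simpa using hH) hx
  rw [zero_add] at h
  simpa using h


/-! ### The word identity and the Fréchet norm from partials -/

/-- **The word identity**: for `H` of class `C^q` on an open `U` and `r : Fin q → Fin N`,
`D^q H(x)(e_{r 0}, …, e_{r (q-1)}) = ∂^{[r 0, …, r (q-1)]} H(x)`. [folklore] -/
theorem iteratedFDeriv_apply_single {U : Set (Fin N → ℝ)} (hU : IsOpen U) :
    ∀ {q : ℕ} {H : (Fin N → ℝ) → ℝ}, ContDiffOn ℝ (q : WithTop ℕ∞) H U → ∀ {x}, x ∈ U →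
      ∀ r : Fin q → Fin N,
        iteratedFDeriv ℝ q H x (fun j => Pi.single (r j) 1) = pderivWord (List.ofFn r) H x
  | 0, H, _, x, _, r => by simp
  | q + 1, H, hH, x, hx, r => by
    have hsnoc : (fun j : Fin (q + 1) => (Pi.single (r j) 1 : Fin N → ℝ)) =
        Fin.snoc (fun j : Fin q => Pi.single (r (Fin.castSucc j)) 1) (Pi.single (r (Fin.last q)) 1) := by
      symm; exact Fin.snoc_init_self (fun j : Fin (q + 1) => (Pi.single (r j) 1 : Fin N → ℝ))
    rw [hsnoc, ← iteratedFDeriv_pderiv_apply hU (by exact_mod_cast hH) (r (Fin.last q)) hx,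
      iteratedFDeriv_apply_single hU (ContDiffOn.pderiv hU (by exact_mod_cast hH) _) hx,
      List.ofFn_succ_last, pderivWord_append]
    rfl

/-- **The Fréchet norm from bounds on the partials**: if `H` is `C^q` on an open `U` and all
iterated partials of order `q` at `x ∈ U` are at most `M ≥ 0` in absolute value, then
`‖D^q H(x)‖ ≤ N^q M`. [folklore] -/
theorem norm_iteratedFDeriv_le_of_pderivWord {U : Set (Fin N → ℝ)} (hU : IsOpen U)
    {q : ℕ} {H : (Fin N → ℝ) → ℝ} (hH : ContDiffOn ℝ (q : WithTop ℕ∞) H U) {x : Fin N → ℝ} (hx : x ∈ U)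
    {M : ℝ} (hM : 0 ≤ M) (hb : ∀ r : Fin q → Fin N, |pderivWord (List.ofFn r) H x| ≤ M) :
    ‖iteratedFDeriv ℝ q H x‖ ≤ (N : ℝ) ^ q * M := by
  classical
  refine ContinuousMultilinearMap.opNorm_le_bound (by positivity) fun u => ?_
  -- expand each `u j` in the basis
  have hu : u = fun j => ∑ i : Fin N, u j i • (Pi.single i 1 : Fin N → ℝ) := by
    funext j; ext l; simp [Finset.sum_apply, Pi.single_apply]
  set A := iteratedFDeriv ℝ q H x with hA
  have hexp : A u = ∑ r : Fin q → Fin N, A (fun j => u j (r j) • (Pi.single (r j) 1 : Fin N → ℝ)) := by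
    conv_lhs => rw [hu]
    exact A.toMultilinearMap.map_sum (fun j i => u j i • (Pi.single i 1 : Fin N → ℝ))
  rw [hexp]
  have hterm : ∀ r : Fin q → Fin N,
      ‖A (fun j => u j (r j) • (Pi.single (r j) 1 : Fin N → ℝ))‖ ≤ M * ∏ j, ‖u j‖ := by
    intro r
    rw [A.map_smul_univ, norm_smul, Real.norm_eq_abs, Finset.abs_prod, hA,
      iteratedFDeriv_apply_single hU hH hx r, Real.norm_eq_abs, mul_comm]
    refine mul_le_mul (hb r) (Finset.prod_le_prod (fun j _ => abs_nonneg _) fun j _ => ?_)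
      (Finset.prod_nonneg fun _ _ => abs_nonneg _) hM
    rw [← Real.norm_eq_abs]
    exact norm_le_pi_norm (u j) (r j)
  calc ‖∑ r : Fin q → Fin N, A (fun j => u j (r j) • (Pi.single (r j) 1 : Fin N → ℝ))‖
      ≤ ∑ r : Fin q → Fin N, ‖A (fun j => u j (r j) • (Pi.single (r j) 1 : Fin N → ℝ))‖ := norm_sum_le _ _
    _ ≤ ∑ _r : Fin q → Fin N, M * ∏ j, ‖u j‖ := Finset.sum_le_sum fun r _ => hterm r
    _ = (N : ℝ) ^ q * M * ∏ j, ‖u j‖ := by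
        rw [Finset.sum_const, Finset.card_univ, Fintype.card_fun, Fintype.card_fin, Fintype.card_fin,
          nsmul_eq_mul]
        push_cast; ring

/-! ### Partial derivatives as one-variable derivatives of sections -/

/-- `∂_i K(x)` is the derivative of the section `s ↦ K(x with x_i := s)` at `x_i`, for `K`
differentiable at `x`. [folklore] -/
theorem hasDerivAt_section_of_differentiableAt {K : (Fin N → ℝ) → ℝ} {x : Fin N → ℝ}
    (hK : DifferentiableAt ℝ K x) (i : Fin N) :
    HasDerivAt (fun s => K (Function.update x i s)) (pderiv i K x) (x i) := by
  have h : HasFDerivAt K (fderiv ℝ K x) (Function.update x i (x i)) := by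
    rw [Function.update_eq_self]; exact hK.hasFDerivAt
  exact h.comp_hasDerivAt (x i) (hasDerivAt_update x i (x i))

/-- `∂_i K(x)` as the derivative of a section (`deriv` form). [folklore] -/
theorem pderiv_eq_deriv_section {K : (Fin N → ℝ) → ℝ} {x : Fin N → ℝ}
    (hK : DifferentiableAt ℝ K x) (i : Fin N) :
    pderiv i K x = deriv (fun s => K (Function.update x i s)) (x i) :=
  (hasDerivAt_section_of_differentiableAt hK i).deriv.symm


/-! ### Congruence, products, and the change of the last variable `I_ψ` -/

/-- Partial derivatives of functions agreeing on an open set agree there. [folklore] -/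
theorem pderiv_congr_of_eqOn {U : Set (Fin N → ℝ)} (hU : IsOpen U) {K K' : (Fin N → ℝ) → ℝ}
    (h : EqOn K K' U) (i : Fin N) : EqOn (pderiv i K) (pderiv i K') U := by
  intro x hx
  simp only [pderiv]
  rw [Filter.EventuallyEq.fderiv_eq (h.eventuallyEq_of_mem (hU.mem_nhds hx))]

/-- Iterated partials of functions agreeing on an open set agree there. [folklore] -/
theorem pderivWord_congr_of_eqOn {U : Set (Fin N → ℝ)} (hU : IsOpen U) {K K' : (Fin N → ℝ) → ℝ}
    (h : EqOn K K' U) : ∀ w : List (Fin N), EqOn (pderivWord w K) (pderivWord w K') U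
  | [] => h
  | i :: w => by
    rw [pderivWord_cons, pderivWord_cons]
    exact pderiv_congr_of_eqOn hU (pderivWord_congr_of_eqOn hU h w) i

/-- Product rule for `∂_i`. [folklore] -/
theorem pderiv_mul {G K : (Fin N → ℝ) → ℝ} {x : Fin N → ℝ} (hG : DifferentiableAt ℝ G x)
    (hK : DifferentiableAt ℝ K x) (i : Fin N) :
    pderiv i (fun y => G y * K y) x = pderiv i G x * K x + G x * pderiv i K x := by
  simp only [pderiv]
  rw [show (fun y => G y * K y) = G * K from rfl, fderiv_mul hG hK]
  simp only [_root_.add_apply, FunLike.coe_smul, Pi.smul_apply, smul_eq_mul]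
  ring

/-- Functions of the `i₀`-th coordinate only: `∂_i (c ∘ x_{i₀}) = 0` for `i ≠ i₀` and
`= c'(x_{i₀})` for `i = i₀`. [folklore] -/
theorem pderiv_comp_apply {c : ℝ → ℝ} {x : Fin N → ℝ} (i₀ : Fin N) (hc : DifferentiableAt ℝ c (x i₀))
    (i : Fin N) :
    pderiv i (fun y : Fin N → ℝ => c (y i₀)) x = if i = i₀ then deriv c (x i₀) else 0 := by
  have hd : DifferentiableAt ℝ (fun y : Fin N → ℝ => c (y i₀)) x := hc.comp x (differentiableAt_apply i₀ x)
  rw [pderiv_eq_deriv_section hd i]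
  by_cases h : i = i₀
  · subst h
    simp only [Function.update_self, if_true]
  · simp only [Function.update_of_ne (Ne.symm h), if_neg h, deriv_const]

variable {m : ℕ}

/-- The change of the last variable `I_ψ(x) = (x₁, …, x_m, ψ(x_{m+1}))` is differentiable where
`ψ` is. [folklore] -/
theorem differentiableAt_changeLast {ψ : ℝ → ℝ} {x : Fin (m + 1) → ℝ}
    (hψ : DifferentiableAt ℝ ψ (x (Fin.last m))) :
    DifferentiableAt ℝ (fun y : Fin (m + 1) → ℝ => Function.update y (Fin.last m) (ψ (y (Fin.last m)))) x := by
  have heq : (fun y : Fin (m + 1) → ℝ => Function.update y (Fin.last m) (ψ (y (Fin.last m)))) =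
      fun y => y + (ψ (y (Fin.last m)) - y (Fin.last m)) • (Pi.single (Fin.last m) (1 : ℝ) : Fin (m + 1) → ℝ) := by
    funext y; ext j
    by_cases h : j = Fin.last m
    · subst h; simp
    · simp [Function.update_of_ne h, Pi.single_eq_of_ne h]
  rw [heq]
  apply differentiableAt_id.add
  refine DifferentiableAt.smul_const ?_ _
  exact (hψ.comp x (differentiableAt_apply (Fin.last m) x)).sub (differentiableAt_apply (Fin.last m) x)

/-- **Chain rule through `I_ψ`, base directions**: `∂_i (H ∘ I_ψ)(x) = (∂_i H)(I_ψ x)` for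
`i ≠ m+1`. [folklore] -/
theorem pderiv_comp_changeLast_of_ne {H : (Fin (m + 1) → ℝ) → ℝ} {ψ : ℝ → ℝ} {x : Fin (m + 1) → ℝ}
    (hH : DifferentiableAt ℝ H (Function.update x (Fin.last m) (ψ (x (Fin.last m)))))
    (hψ : DifferentiableAt ℝ ψ (x (Fin.last m))) {i : Fin (m + 1)} (hi : i ≠ Fin.last m) :
    pderiv i (fun y => H (Function.update y (Fin.last m) (ψ (y (Fin.last m))))) x =
      pderiv i H (Function.update x (Fin.last m) (ψ (x (Fin.last m)))) := by
  have hcomp : DifferentiableAt ℝ (fun y => H (Function.update y (Fin.last m) (ψ (y (Fin.last m))))) x :=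
    hH.comp x (differentiableAt_changeLast hψ)
  rw [pderiv_eq_deriv_section hcomp i, pderiv_eq_deriv_section hH i]
  have hxi : Function.update x (Fin.last m) (ψ (x (Fin.last m))) i = x i := Function.update_of_ne hi _ _
  rw [hxi]
  congr 1
  funext s
  congr 1
  ext j
  by_cases hj : j = Fin.last m
  · subst hj
    simp [Ne.symm hi]
  · by_cases hji : j = i
    · subst hji; simp [hj]
    · simp [Function.update_of_ne hji, Function.update_of_ne hj]

/-- **Chain rule through `I_ψ`, last direction**:
`∂_{m+1} (H ∘ I_ψ)(x) = ψ'(x_{m+1}) · (∂_{m+1} H)(I_ψ x)`. [folklore] -/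
theorem pderiv_comp_changeLast_last {H : (Fin (m + 1) → ℝ) → ℝ} {ψ : ℝ → ℝ} {x : Fin (m + 1) → ℝ}
    (hH : DifferentiableAt ℝ H (Function.update x (Fin.last m) (ψ (x (Fin.last m)))))
    (hψ : DifferentiableAt ℝ ψ (x (Fin.last m))) :
    pderiv (Fin.last m) (fun y => H (Function.update y (Fin.last m) (ψ (y (Fin.last m))))) x =
      deriv ψ (x (Fin.last m)) * pderiv (Fin.last m) H (Function.update x (Fin.last m) (ψ (x (Fin.last m)))) := by
  have hcomp : DifferentiableAt ℝ (fun y => H (Function.update y (Fin.last m) (ψ (y (Fin.last m))))) x :=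
    hH.comp x (differentiableAt_changeLast hψ)
  rw [pderiv_eq_deriv_section hcomp (Fin.last m)]
  have hsec : (fun s => H (Function.update (Function.update x (Fin.last m) s) (Fin.last m)
      (ψ (Function.update x (Fin.last m) s (Fin.last m))))) =
      (fun c => H (Function.update (Function.update x (Fin.last m) (ψ (x (Fin.last m)))) (Fin.last m) c)) ∘ ψ := by
    funext s
    simp [Function.update_idem]
  rw [hsec]
  have h1 := hasDerivAt_section_of_differentiableAt hH (Fin.last m)
  simp only [Function.update_self] at h1
  rw [(h1.comp (x (Fin.last m)) hψ.hasDerivAt).deriv]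
  ring

/-- **`t`-partials are one-variable derivatives of the sections**: for `K` of class `C^a` on an
open `U ∋ x`, `∂_{m+1}^a K(x) = (d/ds)^a K(x with x_{m+1} := s)|_{s = x_{m+1}}`. [folklore] -/
theorem pderivWord_replicate_last {U : Set (Fin (m + 1) → ℝ)} (hU : IsOpen U) :
    ∀ (a : ℕ) {K : (Fin (m + 1) → ℝ) → ℝ}, ContDiffOn ℝ (a : WithTop ℕ∞) K U → ∀ {x}, x ∈ U →
      pderivWord (List.replicate a (Fin.last m)) K x =
        iteratedDeriv a (fun s => K (Function.update x (Fin.last m) s)) (x (Fin.last m))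
  | 0, K, _, x, _ => by simp
  | a + 1, K, hK, x, hx => by
    rw [List.replicate_succ, pderivWord_cons]
    have hKa : ContDiffOn ℝ (((0 : ℕ) + (List.replicate a (Fin.last m)).length : ℕ) : WithTop ℕ∞) K U := by
      simp only [List.length_replicate, zero_add]
      exact hK.of_le (by exact_mod_cast Nat.le_succ a)
    have hKa1 : ContDiffOn ℝ (((1 : ℕ) + (List.replicate a (Fin.last m)).length : ℕ) : WithTop ℕ∞) K U := by
      simp only [List.length_replicate]
      rwa [show 1 + a = a + 1 by ring]
    have hG1 : ContDiffOn ℝ 1 (pderivWord (List.replicate a (Fin.last m)) K) U :=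
      ContDiffOn.pderivWord hU _ hKa1
    have hGd : DifferentiableAt ℝ (pderivWord (List.replicate a (Fin.last m)) K) x :=
      (hG1.differentiableOn one_ne_zero x hx).differentiableAt (hU.mem_nhds hx)
    rw [pderiv_eq_deriv_section hGd, iteratedDeriv_succ]
    -- the sections agree near `x_{m+1}`
    apply Filter.EventuallyEq.deriv_eq
    have hnear : ∀ᶠ s in 𝓝 (x (Fin.last m)), Function.update x (Fin.last m) s ∈ U := by
      have hc : Continuous (fun s => Function.update x (Fin.last m) s) := by
        exact continuous_const.update (Fin.last m) continuous_id
      have := hc.continuousAt.preimage_mem_nhds (by rw [Function.update_eq_self]; exact hU.mem_nhds hx)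
      exact this
    filter_upwards [hnear] with s hs
    rw [pderivWord_replicate_last hU a (hK.of_le (by exact_mod_cast Nat.le_succ a)) hs]
    simp [Function.update_idem]


/-! ### Symmetry of iterated partials for smooth functions -/

/-- `∂_i ∂_j G(x) = D²G(x)(e_i)(e_j)` for `G` of class `C²` on an open `U ∋ x`. [folklore] -/
theorem pderiv_pderiv_eq_fderiv_fderiv {U : Set (Fin N → ℝ)} (hU : IsOpen U) {G : (Fin N → ℝ) → ℝ}
    (hG : ContDiffOn ℝ 2 G U) {x : Fin N → ℝ} (hx : x ∈ U) (i j : Fin N) :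
    pderiv i (pderiv j G) x = fderiv ℝ (fderiv ℝ G) x (Pi.single i 1) (Pi.single j 1) := by
  have h1 : ContDiffOn ℝ 1 (fderiv ℝ G) U := hG.fderiv_of_isOpen hU (by norm_num)
  have hd : DifferentiableAt ℝ (fderiv ℝ G) x := (h1.differentiableOn one_ne_zero x hx).differentiableAt (hU.mem_nhds hx)
  show fderiv ℝ (fun y => fderiv ℝ G y (Pi.single j 1)) x (Pi.single i 1) = _
  rw [fderiv_clm_apply hd (differentiableAt_const _), fderiv_fun_const]
  simp

/-- **Mixed partials commute** (Schwarz): `∂_i ∂_j G = ∂_j ∂_i G` on an open `U` where `G` is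
`C²`. [folklore] -/
theorem pderiv_comm {U : Set (Fin N → ℝ)} (hU : IsOpen U) {G : (Fin N → ℝ) → ℝ}
    (hG : ContDiffOn ℝ 2 G U) {x : Fin N → ℝ} (hx : x ∈ U) (i j : Fin N) :
    pderiv i (pderiv j G) x = pderiv j (pderiv i G) x := by
  rw [pderiv_pderiv_eq_fderiv_fderiv hU hG hx, pderiv_pderiv_eq_fderiv_fderiv hU hG hx]
  have hsymm : IsSymmSndFDerivAt ℝ G x :=
    ((hG x hx).contDiffAt (hU.mem_nhds hx)).isSymmSndFDerivAt (by simp)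
  exact hsymm _ _

/-- **Iterated partials of a `C^{|w|}` function do not depend on the order of differentiation.**
[folklore] -/
theorem pderivWord_perm {U : Set (Fin N → ℝ)} (hU : IsOpen U) {H : (Fin N → ℝ) → ℝ} {w w' : List (Fin N)}
    (hp : w.Perm w') (hH : ContDiffOn ℝ (w.length : WithTop ℕ∞) H U) :
    EqOn (pderivWord w H) (pderivWord w' H) U := by
  induction hp with
  | nil => exact fun _ _ => rfl
  | cons i p ih =>
    rename_i l₁ l₂
    rw [pderivWord_cons, pderivWord_cons]
    have hH' : ContDiffOn ℝ (l₁.length : WithTop ℕ∞) H U := hH.of_le (by simp)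
    exact pderiv_congr_of_eqOn hU (ih hH') i
  | swap i j l =>
    -- `∂_j ∂_i K = ∂_i ∂_j K` for `K = ∂^l H`, of class `C²`
    rw [pderivWord_cons, pderivWord_cons, pderivWord_cons, pderivWord_cons]
    have hH2 : ContDiffOn ℝ (((2 : ℕ) + l.length : ℕ) : WithTop ℕ∞) H U := by
      convert hH using 2; simp; ring
    have hK : ContDiffOn ℝ 2 (pderivWord l H) U := by exact_mod_cast ContDiffOn.pderivWord hU l hH2
    intro x hx
    exact pderiv_comm hU hK hx j i
  | trans _ _ ih₁ ih₂ =>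
    rename_i l₁ l₂ l₃ p₁ p₂
    have hH₂ : ContDiffOn ℝ (l₂.length : WithTop ℕ∞) H U := by rwa [← p₁.length_eq]
    exact (ih₁ hH).trans (ih₂ hH₂)

end PDeriv


end Literature.ModelTheory.ExponentialFields

end
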